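/-
Copyright (c) 2026 the pub-hodgecm-mathlib formalisation cell (harness21).  Prover seat hodgecm-mathlib-K2E1-p13 (g2), Track B ∕ K2-LIT, h413 = `stmt-HodgeConjecture-24833`,
line `K2_E1_TraceFormulaBeta`, ROADCARD «5Res ENDGAME BY FAMILIES» (dealer K2E1-plan (g7) (214)∕(226)∕(229)): the GALOIS TWIST of Mok's quasi-split unitary group `U_{E∕F}(N)(𝔸_F)`
by the involution `c ∈ Gal(E∕F)` — existence as a composite of ★ defs, and its compatibilities with the Borel height, the flat sections, the Borel subgroup and its unipotent radical.
FILE 1 of the (H2) infrastructure behind the letter `htube` of ★ `K2E1ChiScatteringConjSymmetryCMTwo`.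
-/
import Summits.HodgeConjecture.HodgeConjecture.Theorems.K2E1BorelEisensteinUDefs   -- ★ `flatSectionU` (ns `…K2E1BorelEisensteinU`); brings ★ Literature `UnitaryGroupBorelHeight` (`borelHeight`, `lastRow`) + `AdelicVectorHeightGalois` (`vecHeight_galSmul`)
import Literature.NumberTheory.Automorphic.UnitaryGroupGlobalGenericity             -- ★ `conjAdele_conjAdele` (`(c⊗1)² = 1`); brings ★ `UnitaryGroupGenericity` (`adelicUnipotent`, `mem_adelicUnipotent_iff`)
import HarnessLib

/-!
# `K2E1QuasiSplitGaloisTwistU2` — THE GALOIS TWIST `c_G` OF `U_{E∕F}(N)(𝔸_F)`: existence, involutivity, height invariance, flat sections, Borel and unipotent stability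

Track B ∕ K2-LIT, crux h413 = `stmt-HodgeConjecture-24833`, route of record `HCCMUnconditional`; cell `hodgecm-mathlib`, squad K2, ENGINE E1.  THEOREMS ONLY (no `def`, no `instance`,
no `notation`, no `sorry`; default heartbeats); lane `--supports stmt-HodgeConjecture-24833 --as helper` (count-neutral).  Rank-GENERIC `(F, E, c, N)`.

THE MATHEMATICS ([MoeglinWaldspurger1995, I.1.4, II.1.5]; [Rogawski1990, §1.9–§1.10]; [Garrett2018, §2.2]).  `G = U(J_N)` is defined over `F`, so the non-trivial element `c` of `Gal(E∕F)`
acts on `G(𝔸_F) ≤ GL_N(𝔸_E)` ENTRYWISE through `c ⊗ 1` (★ `conjAdele F E c`, `= c • ·`): the defining relation `((c⊗1) g)ᵀ J g = J` is preserved because `J = J_N` has integer entries (★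
`StdForm.over_map`).  NO new definition is introduced: the twist is the composite of ★ `Matrix.GeneralLinearGroup.map (conjAdele F E c)` with the subgroup inclusion, co-restricted — we state
its EXISTENCE (**`exists_galTwist`**) and prove every compatibility HYPOTHESIS-FIRST on a binder `cG : G(𝔸) →* G(𝔸)` with the characterisation **(hcG)**
`∀ g, adelicVal (cG g) = GeneralLinearGroup.map (conjAdele F E c) (adelicVal g)` (a future Defs-filer name plugs in by `rfl`).
* §1 `map_conjAdele_mem_adelic`, **`exists_galTwist`**, `galTwist_galTwist` (`c² = 1` ⇒ `c_G² = id`, ★ `conjAdele_conjAdele`), `galTwist_injective`.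
* §2 **`lastRow_galTwist`** (`e_N·c_G(g) = c • (e_N·g)`), **`borelHeight_galTwist`** (`H(c_G g) = H(g)`: the height of an adelic vector is Galois-invariant, ★ Literature
  `vecHeight_galSmul` — places are permuted), **`flatSectionU_comp_galTwist`** (`f_z^{φ∘c_G} = f_z^φ ∘ c_G`).
* §3 **`galTwist_mem_borelAdelic_iff`**, **`galTwist_mem_adelicUnipotent_iff`** (`c ⊗ 1` is injective and fixes `0`, `1`: block-triangularity and unit diagonal are preserved both ways).
FILE 2 (next): `N = 2` — `c_G(u) = u⁻¹` on `N(𝔸_F)` (the trace-zero line, `c(x) = −x`) hence `(c_G|_N)_* ν = ν` for inversion-invariant Haar `ν`, `c_G(w₀) = w₀`, the change of variables in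
the intertwining integral; and the letters (K) `K_max`-stability, (S) `χ`-sections ↦ `(χ∘c)`-sections.
HONEST LABEL: HC_CM is proved only modulo the 7 printed citations (2 remaining named inputs: hLiu418 = `stmt-HodgeConjecture-24832`, h413 = `stmt-HodgeConjecture-24833`) until rung 0
closes; this file asserts no named fact, closes no socket; count-neutral; letter-free.
[cite: MoeglinWaldspurger1995, I.1.4 and II.1.5] [cite: Rogawski1990, §1.9–§1.10] [cite: Garrett2018, §2.2 (PDF p. 83)]

## References
* [MoeglinWaldspurger1995] C. Mœglin, J.-L. Waldspurger, *Spectral decomposition and Eisenstein series* (1995), I.1.4, II.1.5.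
* [Rogawski1990] J. D. Rogawski, *Automorphic Representations of Unitary Groups in Three Variables* (1990), §1.9–§1.10.
* [Garrett2018] P. Garrett, *Modern Analysis of Automorphic Forms by Example* (2018), §2.2.
-/

set_option autoImplicit false
set_option linter.dupNamespace false  -- the mandated namespace repeats the summit's segment (`HodgeConjecture.HodgeConjecture`)

noncomputable section

open NumberField IsDedekindDomain
open scoped NNReal MatrixGroups
open Literature.NumberTheory.Automorphic Literature.NumberTheory.Automorphic.UnitaryGroup AdelicGroupData
open Summit.HodgeConjecture.HodgeConjecture.Cruxes.H413.K2E1BorelEisensteinU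

namespace Summit.HodgeConjecture.HodgeConjecture.Cruxes.H413.K2E1QuasiSplitGaloisTwistU2

variable {F E : Type} [Field F] [NumberField F] [Field E] [NumberField E] [Algebra F E] {c : E ≃ₐ[F] E} {N : ℕ}

/-! ## §1 Existence of the Galois twist as a composite of ★ definitions; involutivity -/

/-- **`(c ⊗ 1)` APPLIED ENTRYWISE PRESERVES `U(J_N)(𝔸_F)`**: the defining relation `((c⊗1)g)ᵀ J_N g = J_N` is mapped to itself (★ `map_mem_unitaryGroupOfForm`; `J_N` has integer entries,
★ `StdForm.over_map`). [cite: MoeglinWaldspurger1995, I.1.4] [cite: Rogawski1990, §1.9] -/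
theorem map_conjAdele_mem_adelic (g : (quasiSplit F E c N).Adelic) :
    Matrix.GeneralLinearGroup.map (conjAdele F E c) (adelicVal F E c N _ g) ∈ adelic F E c N ((StdForm.antidiagonal N).over E) := by
  have h := map_mem_unitaryGroupOfForm (σ := conjAdele F E c) (τ := conjAdele F E c) (conjAdele F E c) (fun _ => rfl) (adelicVal_mem_unitaryGroupOfForm g)
  rw [StdForm.over_map] at h
  rw [← adelicForm_antidiagonal] at h
  exact h

variable (F E c N) in
/-- **EXISTENCE OF THE GALOIS TWIST `c_G : U(J_N)(𝔸_F) →* U(J_N)(𝔸_F)`** with `adelicVal (c_G g) = (c ⊗ 1)(adelicVal g)` entrywise — the composite of ★ `GeneralLinearGroup.map (conjAdele F E c)`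
with the inclusion, co-restricted by §1.  (No new definition: consumers `obtain` it; the compatibilities below are stated for ANY hom with this characterisation.)
[cite: MoeglinWaldspurger1995, I.1.4] [cite: Rogawski1990, §1.9] -/
theorem exists_galTwist : ∃ cG : (quasiSplit F E c N).Adelic →* (quasiSplit F E c N).Adelic,
    ∀ g, adelicVal F E c N _ (cG g) = Matrix.GeneralLinearGroup.map (conjAdele F E c) (adelicVal F E c N _ g) :=
  ⟨((Matrix.GeneralLinearGroup.map (conjAdele F E c)).comp (adelicVal F E c N _)).codRestrict (adelic F E c N ((StdForm.antidiagonal N).over E))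
    (fun g => map_conjAdele_mem_adelic g), fun _ => rfl⟩

omit [NumberField F] in
/-- `c ⊗ 1` is injective (`c² = 1`). [folklore] -/
theorem conjAdele_injective (hc : c * c = 1) : Function.Injective (conjAdele F E c) :=
  fun x y h => by rw [← conjAdele_conjAdele hc x, h, conjAdele_conjAdele hc y]

/-- The matrix of `c_G g` is the entrywise twist of the matrix of `g`. [folklore] -/
theorem coe_adelicVal_galTwist {cG : (quasiSplit F E c N).Adelic →* (quasiSplit F E c N).Adelic}
    (hcG : ∀ g, adelicVal F E c N _ (cG g) = Matrix.GeneralLinearGroup.map (conjAdele F E c) (adelicVal F E c N _ g)) (g : (quasiSplit F E c N).Adelic) :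
    ((adelicVal F E c N _ (cG g) : GL (Fin N) (AdeleRing (𝓞 E) E)) : Matrix (Fin N) (Fin N) (AdeleRing (𝓞 E) E)) =
      ((adelicVal F E c N _ g : GL (Fin N) (AdeleRing (𝓞 E) E)) : Matrix (Fin N) (Fin N) (AdeleRing (𝓞 E) E)).map (conjAdele F E c) := by
  rw [hcG]; rfl

/-- **`c_G` IS AN INVOLUTION**: `c_G (c_G g) = g` (`c² = 1`). [cite: Rogawski1990, §1.9] -/
theorem galTwist_galTwist (hc : c * c = 1) {cG : (quasiSplit F E c N).Adelic →* (quasiSplit F E c N).Adelic}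
    (hcG : ∀ g, adelicVal F E c N _ (cG g) = Matrix.GeneralLinearGroup.map (conjAdele F E c) (adelicVal F E c N _ g)) (g : (quasiSplit F E c N).Adelic) :
    cG (cG g) = g := by
  apply adelicVal_injective F E c N
  apply Units.ext
  rw [coe_adelicVal_galTwist hcG, coe_adelicVal_galTwist hcG, Matrix.map_map]
  conv_rhs => rw [← Matrix.map_id ((adelicVal F E c N _ g : GL (Fin N) (AdeleRing (𝓞 E) E)) : Matrix (Fin N) (Fin N) (AdeleRing (𝓞 E) E))]
  congr 1
  funext x
  exact conjAdele_conjAdele hc x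

/-- `c_G` is injective. [folklore] -/
theorem galTwist_injective (hc : c * c = 1) {cG : (quasiSplit F E c N).Adelic →* (quasiSplit F E c N).Adelic}
    (hcG : ∀ g, adelicVal F E c N _ (cG g) = Matrix.GeneralLinearGroup.map (conjAdele F E c) (adelicVal F E c N _ g)) : Function.Injective cG :=
  fun x y h => by rw [← galTwist_galTwist hc hcG x, h, galTwist_galTwist hc hcG y]

/-! ## §2 The Borel height and the flat sections are `c_G`-invariant -/

section Height

variable [NeZero N]

/-- **`lastRow (c_G g) = c • lastRow g`** (entrywise). [cite: Garrett2018, §2.2 (PDF p. 83)] -/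
theorem lastRow_galTwist {cG : (quasiSplit F E c N).Adelic →* (quasiSplit F E c N).Adelic}
    (hcG : ∀ g, adelicVal F E c N _ (cG g) = Matrix.GeneralLinearGroup.map (conjAdele F E c) (adelicVal F E c N _ g)) (g : (quasiSplit F E c N).Adelic) :
    lastRow (cG g) = c • lastRow g := by
  funext j
  rw [lastRow_apply, coe_adelicVal_galTwist hcG, Matrix.map_apply, conjAdele_apply, galSmul_apply, lastRow_apply]

/-- **THE BOREL HEIGHT IS `c_G`-INVARIANT**: `H(c_G g) = H(g)` — the height of the adelic row vector `e_N·g` is a product over ALL places of `E`, which `c` permutes (★ `vecHeight_galSmul`).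
[cite: Garrett2018, §2.2 (PDF p. 83)] [cite: MoeglinWaldspurger1995, I.1.4] -/
theorem borelHeight_galTwist {cG : (quasiSplit F E c N).Adelic →* (quasiSplit F E c N).Adelic}
    (hcG : ∀ g, adelicVal F E c N _ (cG g) = Matrix.GeneralLinearGroup.map (conjAdele F E c) (adelicVal F E c N _ g)) (g : (quasiSplit F E c N).Adelic) :
    borelHeight (cG g) = borelHeight g := by
  rw [borelHeight_def, borelHeight_def, lastRow_galTwist hcG, vecHeight_galSmul]

/-- **FLAT SECTIONS: `f_z^{φ ∘ c_G} = f_z^φ ∘ c_G`** (height invariance). [cite: MoeglinWaldspurger1995, II.1.5] -/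
theorem flatSectionU_comp_galTwist {cG : (quasiSplit F E c N).Adelic →* (quasiSplit F E c N).Adelic}
    (hcG : ∀ g, adelicVal F E c N _ (cG g) = Matrix.GeneralLinearGroup.map (conjAdele F E c) (adelicVal F E c N _ g))
    (φ : (quasiSplit F E c N).Adelic → ℂ) (z : ℂ) :
    flatSectionU (fun g => φ (cG g)) z = fun g => flatSectionU φ z (cG g) := by
  funext g
  simp only [flatSectionU, borelHeight_galTwist hcG]

/-- Pointwise form: `f_z^φ (c_G g) = φ(c_G g)·H(g)^z`. [cite: MoeglinWaldspurger1995, II.1.5] -/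
theorem flatSectionU_galTwist_apply {cG : (quasiSplit F E c N).Adelic →* (quasiSplit F E c N).Adelic}
    (hcG : ∀ g, adelicVal F E c N _ (cG g) = Matrix.GeneralLinearGroup.map (conjAdele F E c) (adelicVal F E c N _ g))
    (φ : (quasiSplit F E c N).Adelic → ℂ) (z : ℂ) (g : (quasiSplit F E c N).Adelic) :
    flatSectionU φ z (cG g) = φ (cG g) * (((borelHeight g : ℝ≥0) : ℝ) : ℂ) ^ z := by
  simp only [flatSectionU, borelHeight_galTwist hcG]

end Height

/-! ## §3 `c_G` preserves the Borel subgroup and its unipotent radical -/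

section Borel

/-- **`c_G g ∈ B(𝔸_F) ↔ g ∈ B(𝔸_F)`** (`c ⊗ 1` is injective and fixes `0`: upper-triangularity is preserved both ways). [cite: Rogawski1990, §1.9–§1.10] -/
theorem galTwist_mem_borelAdelic_iff (hc : c * c = 1) {cG : (quasiSplit F E c N).Adelic →* (quasiSplit F E c N).Adelic}
    (hcG : ∀ g, adelicVal F E c N _ (cG g) = Matrix.GeneralLinearGroup.map (conjAdele F E c) (adelicVal F E c N _ g)) (g : (quasiSplit F E c N).Adelic) :
    cG g ∈ borelAdelic F E c N ↔ g ∈ borelAdelic F E c N := by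
  rw [mem_borelAdelic_iff, mem_borelAdelic_iff, coe_adelicVal_galTwist hcG]
  refine ⟨fun h i j hij => ?_, fun h i j hij => ?_⟩
  · have h1 := h hij
    rw [Matrix.map_apply, map_eq_zero_iff _ (conjAdele_injective hc)] at h1
    exact h1
  · rw [Matrix.map_apply, h hij, map_zero]

/-- **`c_G g ∈ N(𝔸_F) ↔ g ∈ N(𝔸_F)`** (upper unitriangular: `c ⊗ 1` fixes `0` and `1` and is injective). [cite: Rogawski1990, §1.9–§1.10] -/
theorem galTwist_mem_adelicUnipotent_iff (hc : c * c = 1) {cG : (quasiSplit F E c N).Adelic →* (quasiSplit F E c N).Adelic}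
    (hcG : ∀ g, adelicVal F E c N _ (cG g) = Matrix.GeneralLinearGroup.map (conjAdele F E c) (adelicVal F E c N _ g)) (g : (quasiSplit F E c N).Adelic) :
    cG g ∈ adelicUnipotent F E c N ↔ g ∈ adelicUnipotent F E c N := by
  rw [mem_adelicUnipotent_iff, mem_adelicUnipotent_iff, mem_upperUnitriangular_iff, mem_upperUnitriangular_iff, coe_adelicVal_galTwist hcG]
  refine ⟨fun h => ⟨fun i j hij => ?_, fun i => ?_⟩, fun h => ⟨fun i j hij => ?_, fun i => ?_⟩⟩
  · have h1 := h.1 hij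
    rw [Matrix.map_apply, map_eq_zero_iff _ (conjAdele_injective hc)] at h1
    exact h1
  · have h1 := h.2 i
    rw [Matrix.map_apply] at h1
    exact conjAdele_injective hc (by rw [h1, map_one])
  · rw [Matrix.map_apply, h.1 hij, map_zero]
  · rw [Matrix.map_apply, h.2 i, map_one]

/-- `c_G` restricts to `N(𝔸_F)` (the forward direction, as a map on the subgroup type). [cite: Rogawski1990, §1.9–§1.10] -/
theorem galTwist_unipotent_mem (hc : c * c = 1) {cG : (quasiSplit F E c N).Adelic →* (quasiSplit F E c N).Adelic}
    (hcG : ∀ g, adelicVal F E c N _ (cG g) = Matrix.GeneralLinearGroup.map (conjAdele F E c) (adelicVal F E c N _ g)) (u : ↥(adelicUnipotent F E c N)) :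
    cG (u : (quasiSplit F E c N).Adelic) ∈ adelicUnipotent F E c N :=
  (galTwist_mem_adelicUnipotent_iff hc hcG _).2 u.2

end Borel

end Summit.HodgeConjecture.HodgeConjecture.Cruxes.H413.K2E1QuasiSplitGaloisTwistU2

end
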